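import Mathlib
import Literature.Barriers.Parity.FordMaynardPrimeSieves
import Summits.Parity.GeneralizedHardyLittlewood.Theorems.FordMaynardSieveConst01651SieveConst01651TypeIICoeffs

/-!
# Route `FordMaynardSieveConst01651`, target `SieveConst01651` (stmt-Parity-19185), line `sieve_decomposition`:
# helpers towards `stub_typeIIRegion` — the `|w|`-mass of a union of residue classes `0 mod d` via (I) and (w)

Ford–Maynard, arXiv:2407.14368v1, §7: exceptional sets of the form `{x/2 < n ≤ x : d ∣ n}` (square factors
`p² ∣ n`, boundary bands, …) are discarded by combining the second half of (w) — `|w_n| ≤ w_n + 2x^{ν/10}`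
(Lemma 7.10, p. 31) — with ONE application of the Type-I bound (I) on full intervals.  This file proves that
device once, in the tree's vocabulary (`FordMaynard.TypeI`; the window `(Icc 1 ⌊x⌋₊).filter (x/2 < ·)`):
* `sum_window_dvd_eq_sum_mul` — `∑_{x/2 < n ≤ x, d ∣ n} w(n) = ∑_{f ≤ x, x/2 < d f ≤ x} w(d f)` (`d ≥ 1`);
* `card_window_dvd_le` — `#{x/2 < n ≤ x : d ∣ n} ≤ ⌊x⌋/d`;
* `sum_abs_window_dvd_le` — for `w ≥ −M` (`M ≥ 0`) satisfying (I) at level `x^γ` with exponent `B ≥ 0` and any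
  set `D` of moduli `d ≤ x^γ`: `∑_{d ∈ D} ∑_{x/2 < n ≤ x, d ∣ n} |w(n)| ≤ x/(log x)^B + 2M ∑_{d ∈ D} ⌊x⌋/d`.
Def-free. Nothing here proves anything about the Parity summit.
-/

open Finset

namespace Summit.Parity.GeneralizedHardyLittlewood.FordMaynardSieveConst01651SieveConst01651

/-- Re-indexing the multiples of `d ≥ 1` in the window by the cofactor: `∑_{x/2 < n ≤ x, d ∣ n} w(n) =
∑_{1 ≤ f ≤ ⌊x⌋, x/2 < d f ≤ x} w(d f)` (the inner sums of (I) with the full interval). [folklore] -/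
theorem sum_window_dvd_eq_sum_mul (w : ℕ → ℝ) (x : ℝ) {d : ℕ} (hd : 1 ≤ d) :
    ∑ n ∈ ((Icc 1 ⌊x⌋₊).filter (fun n : ℕ => x / 2 < (n : ℝ))).filter (fun n => d ∣ n), w n =
      ∑ f ∈ (Icc 1 ⌊x⌋₊).filter (fun f : ℕ => x / 2 < (d * f : ℝ) ∧ (d * f : ℝ) ≤ x), w (d * f) := by
  refine Finset.sum_nbij' (fun n => n / d) (fun f => d * f) ?_ ?_ ?_ ?_ ?_
  · intro n hn
    rw [Finset.mem_filter, Finset.mem_filter, Finset.mem_Icc] at hn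
    obtain ⟨⟨⟨hn1, hnx⟩, hwin⟩, hdvd⟩ := hn
    have hx1 : (1 : ℝ) ≤ x := Nat.floor_pos.mp (by omega)
    have hnd : d * (n / d) = n := Nat.mul_div_cancel' hdvd
    have hcast : ((d : ℝ) * ((n / d : ℕ) : ℝ)) = (n : ℝ) := by exact_mod_cast hnd
    rw [Finset.mem_filter, Finset.mem_Icc, hcast]
    refine ⟨⟨?_, (Nat.div_le_self n d).trans hnx⟩, hwin, ?_⟩
    · exact Nat.div_pos (Nat.le_of_dvd (by omega) hdvd) (by omega)
    · exact (Nat.cast_le.mpr hnx).trans (Nat.floor_le (by linarith))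
  · intro f hf
    rw [Finset.mem_filter, Finset.mem_Icc] at hf
    obtain ⟨⟨hf1, _⟩, hlo, hhi⟩ := hf
    rw [Finset.mem_filter, Finset.mem_filter, Finset.mem_Icc]
    have hcast : (((d * f : ℕ) : ℝ)) = (d : ℝ) * (f : ℝ) := by push_cast; ring
    refine ⟨⟨⟨Nat.one_le_iff_ne_zero.mpr (mul_ne_zero (by omega) (by omega)), ?_⟩, ?_⟩, Dvd.intro _ rfl⟩
    · exact Nat.le_floor (by rw [hcast]; exact hhi)
    · rw [hcast]; exact hlo
  · intro n hn
    rw [Finset.mem_filter] at hn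
    exact Nat.mul_div_cancel' hn.2
  · intro f _
    exact Nat.mul_div_cancel_left f (by omega)
  · intro n hn
    rw [Finset.mem_filter] at hn
    rw [Nat.mul_div_cancel' hn.2]

/-- `#{x/2 < n ≤ x : d ∣ n} ≤ ⌊x⌋ / d`. [folklore] -/
theorem card_window_dvd_le (x : ℝ) (d : ℕ) :
    (((Icc 1 ⌊x⌋₊).filter (fun n : ℕ => x / 2 < (n : ℝ))).filter (fun n => d ∣ n)).card ≤ ⌊x⌋₊ / d := by
  rw [← Nat.Ioc_filter_dvd_card_eq_div ⌊x⌋₊ d]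
  refine Finset.card_le_card fun n hn => ?_
  rw [Finset.mem_filter, Finset.mem_filter, Finset.mem_Icc] at hn
  rw [Finset.mem_filter, Finset.mem_Ioc]
  exact ⟨⟨by omega, hn.1.1.2⟩, hn.2⟩

/-- **`|w|`-mass of multiples via (I) + (w)**: if `w ≥ −M` (`M ≥ 0`; for `w = a − 1`, `a ≥ 0`, take `M = 1`, and
FM's (w) gives `M = x^{ν/10}`) satisfies the Type-I bound (I) at level `x^γ` with exponent `B ≥ 0`, then for every
set `D` of moduli `1 ≤ d ≤ x^γ`,
`∑_{d ∈ D} ∑_{x/2 < n ≤ x, d ∣ n} |w(n)| ≤ x/(log x)^B + 2M ∑_{d ∈ D} ⌊x⌋/d`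
(`|w| ≤ w + 2M` termwise, the `w`-sums re-indexed by the cofactor are inner sums of (I) with full intervals,
`τ(d)^B ≥ 1`). [cite: FordMaynard2024PrimeSieves, Lemma 7.10 (use of (w)) and §1 (I)] -/
theorem sum_abs_window_dvd_le {w : ℕ → ℝ} {x γ B M : ℝ}
    (hI : Literature.Barriers.Parity.FordMaynard.TypeI w x γ B) (hB : 0 ≤ B) (hM : 0 ≤ M)
    (hw : ∀ n, -M ≤ w n) {D : Finset ℕ} (hD : D ⊆ Icc 1 ⌊x ^ γ⌋₊) :
    ∑ d ∈ D, ∑ n ∈ ((Icc 1 ⌊x⌋₊).filter (fun n : ℕ => x / 2 < (n : ℝ))).filter (fun n => d ∣ n), |w n|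
      ≤ x / Real.log x ^ B + 2 * M * ∑ d ∈ D, ((⌊x⌋₊ / d : ℕ) : ℝ) := by
  -- termwise `|w| ≤ w + 2M`, then re-index and bound the `w`-sums by (I)
  have step : ∀ d ∈ D,
      ∑ n ∈ ((Icc 1 ⌊x⌋₊).filter (fun n : ℕ => x / 2 < (n : ℝ))).filter (fun n => d ∣ n), |w n| ≤
        ((d.divisors.card : ℝ) ^ B) *
          |∑ f ∈ (Icc 1 ⌊x⌋₊).filter (fun f : ℕ => x / 2 < (d * f : ℝ) ∧ (d * f : ℝ) ≤ x), w (d * f)| +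
        2 * M * ((⌊x⌋₊ / d : ℕ) : ℝ) := by
    intro d hdD
    have hd1 : 1 ≤ d := (Finset.mem_Icc.mp (hD hdD)).1
    have h1 := sum_abs_le_sum_add (S := ((Icc 1 ⌊x⌋₊).filter (fun n : ℕ => x / 2 < (n : ℝ))).filter
      (fun n => d ∣ n)) hM (fun n _ => hw n)
    rw [sum_window_dvd_eq_sum_mul w x hd1] at h1
    have hτ : (1 : ℝ) ≤ (d.divisors.card : ℝ) ^ B :=
      Real.one_le_rpow (by exact_mod_cast Finset.card_pos.mpr ⟨1, Nat.one_mem_divisors.mpr (by omega)⟩) hB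
    have hcard : ((((Icc 1 ⌊x⌋₊).filter (fun n : ℕ => x / 2 < (n : ℝ))).filter (fun n => d ∣ n)).card : ℝ)
        ≤ ((⌊x⌋₊ / d : ℕ) : ℝ) := by exact_mod_cast card_window_dvd_le x d
    calc _ ≤ _ := h1
      _ ≤ |∑ f ∈ (Icc 1 ⌊x⌋₊).filter (fun f : ℕ => x / 2 < (d * f : ℝ) ∧ (d * f : ℝ) ≤ x), w (d * f)| +
            2 * M * ((⌊x⌋₊ / d : ℕ) : ℝ) :=
          add_le_add (le_abs_self _) (mul_le_mul_of_nonneg_left hcard (by positivity))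
      _ ≤ _ := add_le_add (le_mul_of_one_le_left (abs_nonneg _) hτ) le_rfl
  have hTI := hI (fun _ => (1, ⌊x⌋₊))
  calc ∑ d ∈ D, ∑ n ∈ ((Icc 1 ⌊x⌋₊).filter (fun n : ℕ => x / 2 < (n : ℝ))).filter (fun n => d ∣ n), |w n|
      ≤ ∑ d ∈ D, (((d.divisors.card : ℝ) ^ B) *
          |∑ f ∈ (Icc 1 ⌊x⌋₊).filter (fun f : ℕ => x / 2 < (d * f : ℝ) ∧ (d * f : ℝ) ≤ x), w (d * f)| +
          2 * M * ((⌊x⌋₊ / d : ℕ) : ℝ)) := Finset.sum_le_sum step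
    _ = ∑ d ∈ D, ((d.divisors.card : ℝ) ^ B) *
          |∑ f ∈ (Icc 1 ⌊x⌋₊).filter (fun f : ℕ => x / 2 < (d * f : ℝ) ∧ (d * f : ℝ) ≤ x), w (d * f)| +
        2 * M * ∑ d ∈ D, ((⌊x⌋₊ / d : ℕ) : ℝ) := by
        rw [Finset.sum_add_distrib, Finset.mul_sum]
    _ ≤ ∑ d ∈ Icc 1 ⌊x ^ γ⌋₊, ((d.divisors.card : ℝ) ^ B) *
          |∑ f ∈ (Icc 1 ⌊x⌋₊).filter (fun f : ℕ => x / 2 < (d * f : ℝ) ∧ (d * f : ℝ) ≤ x), w (d * f)| +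
        2 * M * ∑ d ∈ D, ((⌊x⌋₊ / d : ℕ) : ℝ) := by
        refine add_le_add (Finset.sum_le_sum_of_subset_of_nonneg hD fun d _ _ => ?_) le_rfl
        exact mul_nonneg (Real.rpow_nonneg (Nat.cast_nonneg _) _) (abs_nonneg _)
    _ ≤ x / Real.log x ^ B + 2 * M * ∑ d ∈ D, ((⌊x⌋₊ / d : ℕ) : ℝ) := add_le_add hTI le_rfl

end Summit.Parity.GeneralizedHardyLittlewood.FordMaynardSieveConst01651SieveConst01651
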